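import Summits.BirchSwinnertonDyer.Rank1Residual.X5.TwoAdicTargets
import Literature.NumberTheory.EllipticCurves.Rank1Residual.X10MainConjecture
import HarnessLib

/-!
# Class O1 (X5, `p = 2`, non-CM): the END-STATE glue at `2` (G11a) — the `2`-adic chain from ONE
# divisibility datum up to `2ⁿ`, PROVED

HONEST FRAMING (cell `b2b-bsdres`, run/shared/lean/b2b/bsd-rank1-residual/, verbatim in every
file): the goal of the cell is to DELETE the COMBINATION-SHAPED residual classes of the
Birch–Swinnerton-Dyer formula for ALL analytic-rank `≤ 1` elliptic curves over `ℚ` — "full BSD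
formula for every rank `≤ 1` curve in class `C`" assembled STRICTLY from published theorems — so
that the rank-`≤ 1` remainder becomes exactly the CONSTRUCTION-SHAPED classes, which are TYPED
(missing-input `Prop`s), NOT attempted. This is not "finishing BSD". Research routes; no claim
beyond stated classes; census output = EVIDENCE, never a Literature fact; nothing here is booked;
no mark of RESIDUAL-MAP §I moves.

Unit `b2b-bsdres-cc-typer-4` (lane CLASS-CLOSURE, class O1), gen 2, tenth file of the O1 typer
folder: the prover slot **G11a** of the o1 class lead's planner deliverable G11
(`HOME/cells/o1/PLAN.md` v2.2 §10.3 C24; sketch `HOME/b2b-bsdres-o1-lead/G11-EndStateAtTwo.Sketch.lean`,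
sha16 e45e0603fe2c9b6e) PROVED; the consumers G11b–e are the sibling file
`X5/TwoAdicTargetsEndState.lean`. THEOREMS ONLY (no definition, no named fact).

* **G11a `chainUpperAtTwo_of_divisibilityUpTo` (PROVED)** — the `p = 2` twin of the Literature
  theorem `Rank1Residual.chain_of_divisibility` (`X10MainConjecture.lean`, x10 gen 5): good ordinary
  `2`, `L(E,1) ≠ 0`, `Ш` finite, a cyclotomic datum, the newform `f`, a dual datum `D`, a period ratio
  `ϖ` (`ϖ · Ω_E = Ω⁺_f`), and the datum "`X` torsion ∧ `ι g = 2ⁿ · L₂(f, α)` for some `g ∈ char_Λ X`"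
  (= one instance of the E2 target `O1.KatoDivisibilityAtTwoUpTo W k f`, `n ≤ k`); Greenberg's
  Theorem 4.1 AT `2` enters as the HYPOTHESIS `hEC : TwoAdicEulerCharRankZero W 0` (= the published
  parity-free statement: `twoAdicEulerCharRankZero_zero_of_greenberg`, `X5/TwoAdicTargetsPub.lean`,
  from the lit seat's fact `Greenberg1999.thm41_charValue_rankZero_anyPrime`). Conclusion:
  `t = L(E,1)/Ω_E ∈ ℚ` and (a) `ord₂ #Ш + ord₂ ∏c − 2·ord₂ #E(ℚ)_tors + ord₂ ϖ ≤ ord₂ t + n`;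
  (b) if the reverse inequality holds, Mazur's main conjecture at this datum: `char_Λ X = (g)`.
  AUDIT of the odd-`p` template: its binder `hp : p ≠ 2` is consumed ONLY at Step 5 (Greenberg's fact
  `greenberg_charValue_rankZero`, typed with `p ≠ 2`); Steps 0–4 and 6–10 (interpolation
  `constantCoeff_padicLFunction_unitRoot`, the unit bridges, `charIdeal_isPrincipal_holds`,
  `finite_selmerGroupPInfty_of_constantCoeff_ne_zero`, `PowerSeries.isUnit_iff_constantCoeff`) are
  stated at every prime, and the proof below is that template verbatim with `p := 2`, `hGr ↦ hEC`,
  and the datum `ι g = ϖ·L_p ↦ ι g = 2ⁿ·L₂` (so `ϖ` enters only through `[0]⁺_f = t/ϖ`).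
* **G11f `mainConjectureAtTwo_of_divisibilityUpTo_of_le`** (PROVED, clause (b) packaged): on a
  rank-`0` good-ordinary-`2` curve, the datum up to `2ⁿ` plus the REVERSE inequality (what a certified
  `BSD(E,2)` supplies when `n = ord₂ ϖ = 0`) gives `char_Λ X = (g)`, `ι g = 2ⁿ·L₂` — the `p = 2` twin of
  x10's "main conjecture wherever the per-pair lever closes BSD(E,p)".

Nothing is booked; `BSD(E,2)` on any residue cell still needs the E2 target at `k ≤ 1` (NOT in print)
and a certified lower bound.

References: [GreenbergLNM1716] Thm. 4.1 (p. 102), §5; [Kato2004Asterisque] Thm. 17.4 (p. 273), 17.13;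
[MazurTateTeitelbaum1986Invent] §I.14 (14.3); [CastellaEtAl2021] Thm. 5.1.4 (proof shape).
-/

set_option autoImplicit false

noncomputable section

open scoped Classical MatrixGroups ModularForm

open CongruenceSubgroup WeierstrassCurve Literature.NumberTheory.EllipticCurves
  Literature.NumberTheory.EllipticCurves.ModularForms
  Literature.NumberTheory.EllipticCurves.Wuthrich2014
  Literature.NumberTheory.EllipticCurves.Rank1Residual
  Literature.NumberTheory.EllipticCurves.Rank1Residual.Typed

namespace Summit.BirchSwinnertonDyer.Rank1Residual.X5.O1

variable (W : WeierstrassCurve ℚ) [W.IsElliptic] [W.IsGloballyMinimal]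

/-! ## G11a — the `2`-adic chain from ONE divisibility datum up to `2ⁿ` -/

/-- **G11a — the chain at `2` from ONE divisibility datum up to `2ⁿ` (any image).** Let `W` be a
globally minimal model of `E/ℚ`, good ordinary at `2` (`hord`), `L(E,1) ≠ 0` (`hL`), `Ш(E/ℚ)` finite
(`hfin`); Greenberg's Theorem 4.1 AT `2` with no correction term as the hypothesis `hEC`
(`TwoAdicEulerCharRankZero W 0`; in print, LNM 1716 Thm. 4.1 p. 102 parity-free, `p = 2` carried by
Lemmas 4.6/4.7/4.11 — `twoAdicEulerCharRankZero_zero_of_greenberg`). Fix a cyclotomic datum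
(`κ, γ`), a newform `f` of `E` (`hf`), a dual datum `D` (`X = D.X`), a rational `ϖ` with
`ϖ · Ω_E = Ω⁺_f` (`hϖ`), `n : ℕ`, and suppose the DIVISIBILITY DATUM UP TO `2ⁿ` (`hdiv`): `X` is
`Λ`-torsion and `2ⁿ · L₂(f, α) = ι g` for some `g ∈ char_Λ X` (one instance of
`O1.KatoDivisibilityAtTwoUpTo W k f`, `n ≤ k`; for SOME `n` this is Kato 17.4 (1)(2) at `2`, in print).
Then `L(E,1)/Ω_E` is a rational `t` with
(a) `ord₂ #Ш + ord₂ ∏ c_ℓ - 2 ord₂ #E(ℚ)_tors + ord₂ ϖ ≤ ord₂ t + n`, and (b) if conversely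
`ord₂ t + n ≤ ord₂ #Ш + ord₂ ∏ c_ℓ - 2 ord₂ #E(ℚ)_tors + ord₂ ϖ` then the main conjecture holds at
this datum: `char_Λ X = (g)` with `ι g = 2ⁿ · L₂(f, α)`. Proof = `Rank1Residual.chain_of_divisibility`
verbatim with `p := 2`: `g = h · f_E`; interpolation `g(0) = 2ⁿ (1 - α⁻¹)² [0]⁺_f`, `[0]⁺_f = t/ϖ`;
Thm. 4.1 at `2`; the anomalous factor `(1 - α⁻¹)² ~ #Ẽ(𝔽₂)(2)²` cancels; so
`n + ord₂ t - ord₂ ϖ + 2 ord₂ #E(ℚ)_tors = ord₂ h(0) + ord₂ ∏ c_ℓ + ord₂ #Ш`, `ord₂ h(0) ≥ 0` — (a);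
under (b) `ord₂ h(0) = 0`, `h ∈ Λ^×`, `(g) = (f_E)`.
[cite: GreenbergLNM1716, Thm. 4.1 (p. 102) and §5 (closing examples)]
[cite: MazurTateTeitelbaum1986Invent, §I.14 (14.3)] [cite: Kato2004Asterisque, Thm. 17.4 (p. 273)] -/
theorem chainUpperAtTwo_of_divisibilityUpTo (hEC : TwoAdicEulerCharRankZero W 0)
    (hord : IsOrdinaryAt W 2) (hL : W.entireLFunction 1 ≠ 0) (hfin : Finite W.sha)
    {κ : ZpExtension ℚ 2} {γ : Field.absoluteGaloisGroup ℚ} {N : ℕ} [NeZero N]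
    {f : CuspForm (Gamma0 N) 2} (hκ : κ.IsCyclotomic) (hγ : κ.IsTopGenerator γ)
    (hγ' : IsCyclotomicVariable 2 γ) (hf : IsNewformOf W f) (D : W.SelmerDualData κ γ) (ϖ : ℚ)
    (hϖ : (ϖ : ℝ) * W.realPeriodRat = plusPeriod f) (n : ℕ)
    (hdiv : D.IsTorsion ∧ ∃ g ∈ D.charIdeal, iwasawaToPowerSeries 2 g =
        PowerSeries.C ((2 : ℚ_[2]) ^ n) * padicLFunction f (unitRoot W 2 : ℚ_[2])) :
    ∃ t : ℚ, W.entireLFunction 1 / (W.realPeriodRat : ℂ) = (t : ℂ) ∧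
      (padicValNat 2 W.shaOrder : ℤ) + padicValNat 2 W.tamagawaProduct -
          2 * padicValNat 2 W.torsionOrder + padicValRat 2 ϖ ≤ padicValRat 2 t + n ∧
      (padicValRat 2 t + n ≤ (padicValNat 2 W.shaOrder : ℤ) + padicValNat 2 W.tamagawaProduct -
          2 * padicValNat 2 W.torsionOrder + padicValRat 2 ϖ →
        D.IsTorsion ∧ ∃ g : IwasawaAlgebra 2, D.charIdeal = Ideal.span {g} ∧
          iwasawaToPowerSeries 2 g =
            PowerSeries.C ((2 : ℚ_[2]) ^ n) * padicLFunction f (unitRoot W 2 : ℚ_[2])) := by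
  -- Step 0: the rational number `t = ϖ · [0]⁺_f = L(E,1)/Ω_E`, non-zero; `s = [0]⁺_f`
  have hΩpos : 0 < W.realPeriodRat := W.realPeriodRat_pos_holds
  have hϖ0 : ϖ ≠ 0 := by
    rintro rfl
    have hper : 0 < plusPeriod f := IsNewform0.plusPeriod_pos_holds hf.1 hf.coeffField_eq_bot
    rw [← hϖ, Rat.cast_zero, zero_mul] at hper
    exact lt_irrefl _ hper
  set s : ℚ := ratPlusSymbol f 0 with hs_def
  set t : ℚ := ϖ * s with ht_def
  have hLval : W.entireLFunction 1 = (((s : ℝ) * plusPeriod f : ℝ) : ℂ) := hf.entireLFunction_one_eq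
  have hq : W.entireLFunction 1 / (W.realPeriodRat : ℂ) = ((t : ℚ) : ℂ) := by
    rw [hLval, ← hϖ, div_eq_iff (Complex.ofReal_ne_zero.mpr hΩpos.ne'), ht_def]
    push_cast
    ring
  have hs0 : s ≠ 0 := by
    intro h0
    apply hL
    rw [hLval, h0]
    simp
  have hvt : padicValRat 2 t = padicValRat 2 ϖ + padicValRat 2 s := by
    rw [ht_def, padicValRat.mul hϖ0 hs0]
  -- Step 1 (the Iwasawa module)
  haveI : Module.Finite (IwasawaAlgebra 2) D.X := D.module_finite_holds hγ
  -- Step 2 (the divisibility datum): `X` torsion and `ι g = 2ⁿ · L₂(f, α)` for some `g ∈ char_Λ X`;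
  -- a generator `fE` of the (principal) characteristic ideal, and the cofactor `h`: `g = h · fE`
  obtain ⟨hX, g, hgmem, hιg⟩ := hdiv
  haveI : (Module.charIdeal (IwasawaAlgebra 2) D.X).IsPrincipal := charIdeal_isPrincipal_holds 2 D.X
  obtain ⟨fE, hchar⟩ := Submodule.IsPrincipal.principal (Module.charIdeal (IwasawaAlgebra 2) D.X)
  have hchar' : D.charIdeal = Ideal.span {fE} := hchar
  have hgmem' : g ∈ Ideal.span {fE} := by rw [← hchar']; exact hgmem
  obtain ⟨h, hgh⟩ := Ideal.mem_span_singleton'.mp hgmem'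
  -- Step 3 (interpolation): `g(0) = 2ⁿ · (1 - α⁻¹)² [0]⁺_f`
  set a : ℚ_[2] := ((unitRoot W 2 : ℤ_[2]) : ℚ_[2]) with ha
  have hg0 : ((PowerSeries.constantCoeff g : ℤ_[2]) : ℚ_[2]) =
      (2 : ℚ_[2]) ^ n * (1 - a⁻¹) ^ 2 * (s : ℚ_[2]) := by
    rw [← constantCoeff_iwasawaToPowerSeries 2 g, hιg, map_mul, PowerSeries.constantCoeff_C,
      constantCoeff_padicLFunction_unitRoot hord hf]
    ring
  -- `g(0) = h(0) · fE(0)`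
  have hg0' : (PowerSeries.constantCoeff g : ℤ_[2]) =
      PowerSeries.constantCoeff h * PowerSeries.constantCoeff fE := by
    rw [← hgh, map_mul]
  -- the bridges `1 - α⁻¹ = u₂ · #Ẽ(𝔽₂)` and `#Ẽ(𝔽₂) = u₃ · #Ẽ(𝔽₂)(2)`; in particular `1 - α⁻¹ ≠ 0`
  obtain ⟨u₂, hu₂⟩ := exists_unit_one_sub_unitRoot_inv 2 W hord
  haveI : NeZero (2 : ℕ) := ⟨two_ne_zero⟩
  obtain ⟨u₃, hu₃⟩ := exists_unit_natCard_eq_mul_card_primaryComponent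
    ((integralModelInt W).map (Int.castRingHom (ZMod 2))).toAffine.Point 2
  set Np : ℚ_[2] := (Nat.card (AddCommGroup.primaryComponent
    ((integralModelInt W).map (Int.castRingHom (ZMod 2))).toAffine.Point 2) : ℚ_[2]) with hNp
  have hNcount : (W.reductionPointCount 2 : ℚ_[2]) = ((u₃ : ℤ_[2]) : ℚ_[2]) * Np := by
    rw [WeierstrassCurve.reductionPointCount, hNp]
    exact hu₃
  have hNp0 : Np ≠ 0 := by
    rw [hNp]
    exact_mod_cast Nat.card_pos.ne'
  have h1 : (1 - a⁻¹) = ((u₂ : ℤ_[2]) : ℚ_[2]) * ((u₃ : ℤ_[2]) : ℚ_[2]) * Np := by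
    rw [hu₂, hNcount, mul_assoc]
  have hsQ0 : (s : ℚ_[2]) ≠ 0 := by exact_mod_cast hs0
  have hU0 : ((u₂ : ℤ_[2]) : ℚ_[2]) * ((u₃ : ℤ_[2]) : ℚ_[2]) ≠ 0 :=
    mul_ne_zero (coe_units_ne_zero 2 u₂) (coe_units_ne_zero 2 u₃)
  have h20 : (2 : ℚ_[2]) ≠ 0 := two_ne_zero
  -- Step 4 (finiteness): `g(0) ≠ 0`, hence `fE(0) ≠ 0` and `h(0) ≠ 0`, so `Sel_{2^∞}(E/ℚ)` and
  -- `E(ℚ)` are finite (Greenberg p. 103); `Ш` is finite by hypothesis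
  have hg00 : PowerSeries.constantCoeff g ≠ 0 := by
    intro h0
    rw [h0, PadicInt.coe_zero, h1] at hg0
    exact (mul_ne_zero (mul_ne_zero (pow_ne_zero n h20)
      (pow_ne_zero 2 (mul_ne_zero hU0 hNp0))) hsQ0) hg0.symm
  have hfE00 : PowerSeries.constantCoeff fE ≠ 0 := by
    intro h0
    apply hg00
    rw [hg0', h0, mul_zero]
  have hh00 : PowerSeries.constantCoeff h ≠ 0 := by
    intro h0
    apply hg00
    rw [hg0', h0, zero_mul]
  have hSelfin : Finite (W.selmerGroupPInfty 2) :=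
    D.finite_selmerGroupPInfty_of_constantCoeff_ne_zero W hγ hX fE hchar' hfE00
  obtain ⟨hEfin, hShapfin⟩ := (W.finite_selmerGroupPInfty_iff 2).mp hSelfin
  haveI := hEfin
  haveI := hShapfin
  haveI := hSelfin
  haveI : Finite W.sha := hfin
  -- Step 5 (Greenberg's Thm. 4.1 AT 2 — the hypothesis `hEC`, slot `δ = 0` — for the generator `fE`)
  obtain ⟨u₁, hu₁⟩ := hEC hord κ γ hκ hγ hγ' D hX fE hchar' hSelfin
  rw [add_zero, zpow_natCast] at hu₁
  -- Step 6 (the remaining bridges)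
  obtain ⟨u₄, hu₄⟩ := exists_unit_torsionOrder_eq W 2
  obtain ⟨u₅, hu₅⟩ := exists_unit_natCard_eq_mul_card_primaryComponent W.sha 2
  have hSel : Nat.card (W.selmerGroupPInfty 2) = Nat.card (AddCommGroup.primaryComponent W.sha 2) :=
    W.natCard_selmerGroupPInfty_eq_natCard_primaryComponent_sha 2
  -- abbreviations
  set v := padicValNat 2 W.tamagawaProduct with hv
  set Tp : ℚ_[2] := (Nat.card (AddCommGroup.primaryComponent W.toAffine.Point 2) : ℚ_[2]) with hTp
  set Shp : ℚ_[2] := (Nat.card (AddCommGroup.primaryComponent W.sha 2) : ℚ_[2]) with hShp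
  set h0 : ℚ_[2] := ((PowerSeries.constantCoeff h : ℤ_[2]) : ℚ_[2]) with hh0
  have hh0ne : h0 ≠ 0 := by
    rw [hh0]
    intro h0'
    exact hh00 (by exact_mod_cast (PadicInt.coe_eq_zero.mp h0'))
  have hh0val : 0 ≤ h0.valuation := by
    rw [hh0]
    exact PadicInt.valuation_coe_nonneg
  -- `#E(ℚ)_tors = u₄ · Tp` (up to the `DecidableEq ℚ` instance inside the group law)
  have hu₄' : (W.torsionOrder : ℚ_[2]) = ((u₄ : ℤ_[2]) : ℚ_[2]) * Tp := by
    rw [hu₄, hTp]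
    congr 1
    exact_mod_cast natCard_primaryComponent_point_congr W 2 _ _
  -- `#Ш = u₅ · Shp`, `#Sel = Shp`
  have hSha : (W.shaOrder : ℚ_[2]) = ((u₅ : ℤ_[2]) : ℚ_[2]) * Shp := by
    rw [WeierstrassCurve.shaOrder, hShp]
    exact hu₅
  have hSel' : (Nat.card (W.selmerGroupPInfty 2) : ℚ_[2]) = Shp := by rw [hShp, hSel]
  -- `g(0) = h0 · fE(0)` in `ℚ_2`
  have hg0Q : ((PowerSeries.constantCoeff g : ℤ_[2]) : ℚ_[2]) =
      h0 * ((PowerSeries.constantCoeff fE : ℤ_[2]) : ℚ_[2]) := by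
    rw [hg0', hh0]; push_cast; ring
  -- Step 7: the identity `2ⁿ · s · Tp² · (u₂ u₃)² = h0 · u₁ · 2^v · Shp` in `ℚ_2`
  have key : (2 : ℚ_[2]) ^ n * (s : ℚ_[2]) * Tp ^ 2 *
      (((u₂ : ℤ_[2]) : ℚ_[2]) * ((u₃ : ℤ_[2]) : ℚ_[2])) ^ 2 =
      h0 * (((u₁ : ℤ_[2]) : ℚ_[2]) * (2 : ℚ_[2]) ^ v * Shp) := by
    apply mul_right_cancel₀ (pow_ne_zero 2 hNp0)
    calc (2 : ℚ_[2]) ^ n * (s : ℚ_[2]) * Tp ^ 2 *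
          (((u₂ : ℤ_[2]) : ℚ_[2]) * ((u₃ : ℤ_[2]) : ℚ_[2])) ^ 2 * Np ^ 2
        = ((2 : ℚ_[2]) ^ n * (1 - a⁻¹) ^ 2 * (s : ℚ_[2])) * Tp ^ 2 := by rw [h1]; ring
      _ = h0 * (((PowerSeries.constantCoeff fE : ℤ_[2]) : ℚ_[2]) * Tp ^ 2) := by
          rw [← hg0, hg0Q]; ring
      _ = h0 * (((u₁ : ℤ_[2]) : ℚ_[2]) * (2 : ℚ_[2]) ^ v * Np ^ 2 *
            (Nat.card (W.selmerGroupPInfty 2) : ℚ_[2])) := by rw [hu₁]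
      _ = h0 * (((u₁ : ℤ_[2]) : ℚ_[2]) * (2 : ℚ_[2]) ^ v * Shp) * Np ^ 2 := by rw [hSel']; ring
  -- Step 8: valuations
  have hTp0 : Tp ≠ 0 := by rw [hTp]; exact_mod_cast Nat.card_pos.ne'
  have hShp0 : Shp ≠ 0 := by rw [hShp]; exact_mod_cast Nat.card_pos.ne'
  have hv2 : (2 : ℚ_[2]).valuation = 1 := by
    have h2 : ((2 : ℕ) : ℚ_[2]).valuation = 1 := Padic.valuation_p
    rwa [Nat.cast_ofNat] at h2
  have hval := congrArg Padic.valuation key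
  rw [Padic.valuation_mul (mul_ne_zero (mul_ne_zero (pow_ne_zero n h20) hsQ0) (pow_ne_zero 2 hTp0))
      (pow_ne_zero 2 hU0),
    Padic.valuation_mul (mul_ne_zero (pow_ne_zero n h20) hsQ0) (pow_ne_zero 2 hTp0),
    Padic.valuation_mul (pow_ne_zero n h20) hsQ0, Padic.valuation_pow, Padic.valuation_pow,
    Padic.valuation_pow,
    Padic.valuation_mul (coe_units_ne_zero 2 u₂) (coe_units_ne_zero 2 u₃),
    valuation_coe_units_eq_zero, valuation_coe_units_eq_zero,
    Padic.valuation_mul hh0ne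
      (mul_ne_zero (mul_ne_zero (coe_units_ne_zero 2 u₁) (pow_ne_zero v h20)) hShp0),
    Padic.valuation_mul (mul_ne_zero (coe_units_ne_zero 2 u₁) (pow_ne_zero v h20)) hShp0,
    Padic.valuation_mul (coe_units_ne_zero 2 u₁) (pow_ne_zero v h20), valuation_coe_units_eq_zero,
    Padic.valuation_pow, hv2, Padic.valuation_ratCast] at hval
  -- `v(Tp) = v(#E(ℚ)_tors)`, `v(Shp) = v(#Ш)`
  have hvT : Tp.valuation = (padicValNat 2 W.torsionOrder : ℤ) := by
    have h := congrArg Padic.valuation hu₄'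
    rw [Padic.valuation_natCast, Padic.valuation_mul (coe_units_ne_zero 2 u₄) hTp0,
      valuation_coe_units_eq_zero, zero_add] at h
    exact h.symm
  have hvS : Shp.valuation = (padicValNat 2 W.shaOrder : ℤ) := by
    have h := congrArg Padic.valuation hSha
    rw [Padic.valuation_natCast, Padic.valuation_mul (coe_units_ne_zero 2 u₅) hShp0,
      valuation_coe_units_eq_zero, zero_add] at h
    exact h.symm
  rw [hvT, hvS] at hval
  simp only [Nat.cast_ofNat, mul_zero, add_zero, zero_add, mul_one] at hval
  refine ⟨t, hq, by linarith, fun hle => ?_⟩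
  -- Step 9: the reverse inequality forces `ord₂ h(0) = 0`, so `h(0) ∈ ℤ_2^×` and `h ∈ Λ^×`
  have hh0zero : h0.valuation = 0 := by linarith
  have hvalh : (PowerSeries.constantCoeff h : ℤ_[2]).valuation = 0 := by
    have h' : (((PowerSeries.constantCoeff h : ℤ_[2]) : ℚ_[2])).valuation = 0 := by
      rw [← hh0]; exact hh0zero
    rw [PadicInt.valuation_coe] at h'
    exact_mod_cast h'
  have hunit0 : IsUnit (PowerSeries.constantCoeff h : ℤ_[2]) := by
    rw [PadicInt.isUnit_iff, PadicInt.norm_eq_zpow_neg_valuation hh00, hvalh]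
    simp
  have hunit : IsUnit h := PowerSeries.isUnit_iff_constantCoeff.mpr hunit0
  -- Step 10: `char_Λ X = (fE) = (h · fE) = (g)`
  refine ⟨hX, g, ?_, hιg⟩
  rw [hchar', ← hgh, Ideal.span_singleton_mul_left_unit hunit]

/-! ## G11f — clause (b): the main conjecture at `2` from the reverse inequality -/

/-- **G11f — Mazur's main conjecture at a `2`-adic datum from the divisibility datum up to `2ⁿ` and
the REVERSE inequality.** On a globally minimal `W`, good ordinary at `2`, with `L(E,1) ≠ 0` and `Ш`
finite: if `ι g = 2ⁿ·L₂(f, α)` for some `g ∈ char_Λ X` (`X` torsion) and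
`ord₂ (L(E,1)/Ω_E) + n ≤ ord₂ #Ш + ord₂ ∏c_ℓ − 2 ord₂ #E(ℚ)_tors + ord₂ ϖ` for the rational value
`L(E,1)/Ω_E` (what a certified `BSD(E,2)` gives when `n = 0 = ord₂ ϖ`), then `char_Λ X = (g)`. The
`p = 2` twin of x10's `X10.mainConjecture_three_of_surj_of_shaAn_unit`-type closures (clause (b) of
G11a, packaged). [cite: GreenbergLNM1716, §5 (closing examples; shape)] -/
theorem mainConjectureAtTwo_of_divisibilityUpTo_of_le (hEC : TwoAdicEulerCharRankZero W 0)
    (hord : IsOrdinaryAt W 2) (hL : W.entireLFunction 1 ≠ 0) (hfin : Finite W.sha)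
    {κ : ZpExtension ℚ 2} {γ : Field.absoluteGaloisGroup ℚ} {N : ℕ} [NeZero N]
    {f : CuspForm (Gamma0 N) 2} (hκ : κ.IsCyclotomic) (hγ : κ.IsTopGenerator γ)
    (hγ' : IsCyclotomicVariable 2 γ) (hf : IsNewformOf W f) (D : W.SelmerDualData κ γ) (ϖ : ℚ)
    (hϖ : (ϖ : ℝ) * W.realPeriodRat = plusPeriod f) (n : ℕ)
    (hdiv : D.IsTorsion ∧ ∃ g ∈ D.charIdeal, iwasawaToPowerSeries 2 g =
        PowerSeries.C ((2 : ℚ_[2]) ^ n) * padicLFunction f (unitRoot W 2 : ℚ_[2]))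
    (hrev : ∀ t : ℚ, W.entireLFunction 1 / (W.realPeriodRat : ℂ) = (t : ℂ) →
      padicValRat 2 t + n ≤ (padicValNat 2 W.shaOrder : ℤ) + padicValNat 2 W.tamagawaProduct -
          2 * padicValNat 2 W.torsionOrder + padicValRat 2 ϖ) :
    D.IsTorsion ∧ ∃ g : IwasawaAlgebra 2, D.charIdeal = Ideal.span {g} ∧
      iwasawaToPowerSeries 2 g =
        PowerSeries.C ((2 : ℚ_[2]) ^ n) * padicLFunction f (unitRoot W 2 : ℚ_[2]) := by
  obtain ⟨t, ht, -, hb⟩ :=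
    chainUpperAtTwo_of_divisibilityUpTo W hEC hord hL hfin hκ hγ hγ' hf D ϖ hϖ n hdiv
  exact hb (hrev t ht)

end Summit.BirchSwinnertonDyer.Rank1Residual.X5.O1

end
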